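import Mathlib

/-!
# `TowerFourSubLiouville` (stmt-ABC-1649): polynomial enemy families cannot force the uniform saving below `1`

Negative-side structural lemma of the standing disprover (cycle 3, refuter-cdisprove-stmt-ABC-1649-g3-0),
companion of `Negative.UniformSavingCeiling` (p106450).  There, explicit one-parameter POLYNOMIAL families
`w(t) Z(t)⁴ − v(t) Y(t)⁴ = a(t)` refute the uniform binomial quartic saving `UBQ η` for every
`η > (max deg(v,w,a)) / deg Z` (`= 2` for the degree-1 family, `= 3/2` for the degree-2 family).  This file
proves the FLOOR for that method, a direct consequence of Mason–Stothers (`Polynomial.abc` in Mathlib):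

  `masonStothers_enemy_floor`: over a field of characteristic `0`, if `w Z⁴ − v Y⁴ = a` with `v, w, a, Y`
  non-zero, `Z` non-constant and `w Z⁴`, `v Y⁴` coprime, then `deg Z + 1 ≤ max (deg v, deg w, deg a)`.

So a polynomial family of parameter-degree `z = deg Z` has exponent `η = max deg / z ≥ 1 + 1/z > 1`: identities
can push the ceiling of the core stub `stub_genericFormsSaving` towards `1` (degree by degree, if the corresponding
rigid Belyi maps happen to be defined over `ℚ`) but NEVER to or below the probabilistic critical value `η* = 1`.
Any disproof of the crux by an explicit family must therefore be non-polynomial (and would refute `ABC`).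
The two inequalities actually proved are the sharper `3·deg Z + 1 ≤ deg v + deg Y + deg a` and
`3·deg Y + 1 ≤ deg w + deg Z + deg a` (`masonStothers_enemy_ineq`); for `deg Y = deg Z = z` and
`deg v = deg w = m` they read `m + deg a ≥ 2z + 1`, with equality exactly in the Belyi (three-point-ramified)
case — the degree-1 (`m = 2, deg a = 1`) and degree-2 (`m = 2, deg a = 3`) families are such extremal cases.
-/

-- `Summit.ABC.ABC` is the mandated summit-side namespace (CONVENTIONS §2); the duplicate is deliberate.
set_option linter.dupNamespace false

namespace Summit.ABC.ABC.Theorems.TowerFourSubLiouville.Negative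

open Polynomial UniqueFactorizationMonoid UniqueFactorizationDomain

variable {k : Type*} [Field k] [DecidableEq k]

/-- Degree of the radical of `w Z⁴`: at most `deg w + deg Z`. -/
theorem natDegree_radical_mul_pow_four_le {w Z : k[X]} (hw : w ≠ 0) (hZ : Z ≠ 0) :
    (radical (w * Z ^ 4)).natDegree ≤ w.natDegree + Z.natDegree := by
  have h1 : radical (w * Z ^ 4) ∣ w * Z := by
    calc radical (w * Z ^ 4) ∣ radical w * radical (Z ^ 4) := radical_mul_dvd
      _ ∣ w * Z := mul_dvd_mul radical_dvd_self (radical_pow_dvd.trans radical_dvd_self)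
  calc (radical (w * Z ^ 4)).natDegree ≤ (w * Z).natDegree :=
        natDegree_le_of_dvd h1 (mul_ne_zero hw hZ)
    _ = w.natDegree + Z.natDegree := natDegree_mul hw hZ

/-- **Mason–Stothers for binomial quartic identities (the two raw inequalities).**  In characteristic `0`,
`w Z⁴ − v Y⁴ = a` with everything non-zero, `Z` non-constant and `gcd(wZ⁴, vY⁴) = 1` forces
`3 deg Z + 1 ≤ deg v + deg Y + deg a` and `3 deg Y + 1 ≤ deg w + deg Z + deg a`. -/
theorem masonStothers_enemy_ineq [CharZero k] {v w a Y Z : k[X]} (hv : v ≠ 0) (hw : w ≠ 0) (ha : a ≠ 0)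
    (hY : Y ≠ 0) (hZ : 0 < Z.natDegree) (hcop : IsCoprime (w * Z ^ 4) (v * Y ^ 4))
    (hid : w * Z ^ 4 - v * Y ^ 4 = a) :
    3 * Z.natDegree + 1 ≤ v.natDegree + Y.natDegree + a.natDegree ∧
      3 * Y.natDegree + 1 ≤ w.natDegree + Z.natDegree + a.natDegree := by
  have hZ0 : Z ≠ 0 := by rintro rfl; simp at hZ
  set A : k[X] := w * Z ^ 4 with hA
  set B : k[X] := -(v * Y ^ 4) with hB
  set C : k[X] := -a with hC
  have hA0 : A ≠ 0 := mul_ne_zero hw (pow_ne_zero 4 hZ0)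
  have hB0 : B ≠ 0 := neg_ne_zero.mpr (mul_ne_zero hv (pow_ne_zero 4 hY))
  have hC0 : C ≠ 0 := neg_ne_zero.mpr ha
  have hAB : IsCoprime A B := hcop.neg_right
  have hsum : A + B + C = 0 := by rw [hA, hB, hC, ← hid]; ring
  have hdegA : A.natDegree = w.natDegree + 4 * Z.natDegree := by
    rw [hA, natDegree_mul hw (pow_ne_zero 4 hZ0), natDegree_pow]
  have hdegB : B.natDegree = v.natDegree + 4 * Y.natDegree := by
    rw [hB, natDegree_neg, natDegree_mul hv (pow_ne_zero 4 hY), natDegree_pow]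
  -- the radical of `A B C` has degree at most `deg w + deg Z + deg v + deg Y + deg a`
  have hrad : (radical (A * B * C)).natDegree ≤
      (w.natDegree + Z.natDegree) + (v.natDegree + Y.natDegree) + a.natDegree := by
    have hdvd : radical (A * B * C) ∣ radical A * radical B * radical C :=
      radical_mul_dvd.trans (mul_dvd_mul_right radical_mul_dvd _)
    have hrA : (radical A).natDegree ≤ w.natDegree + Z.natDegree := by
      rw [hA]; exact natDegree_radical_mul_pow_four_le hw hZ0
    have hrB : (radical B).natDegree ≤ v.natDegree + Y.natDegree := by
      rw [hB, radical_neg]; exact natDegree_radical_mul_pow_four_le hv hY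
    have hrC : (radical C).natDegree ≤ a.natDegree := by
      rw [hC, radical_neg]; exact natDegree_radical_le
    have hne : radical A * radical B * radical C ≠ 0 :=
      mul_ne_zero (mul_ne_zero radical_ne_zero radical_ne_zero) radical_ne_zero
    calc (radical (A * B * C)).natDegree ≤ (radical A * radical B * radical C).natDegree :=
          natDegree_le_of_dvd hdvd hne
      _ ≤ (radical A * radical B).natDegree + (radical C).natDegree := natDegree_mul_le
      _ ≤ (radical A).natDegree + (radical B).natDegree + (radical C).natDegree :=
          Nat.add_le_add_right natDegree_mul_le _
      _ ≤ _ := by omega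
  rcases Polynomial.abc hA0 hB0 hC0 hAB hsum with ⟨h1, h2, -⟩ | ⟨hdA, -, -⟩
  · rw [hdegA] at h1
    rw [hdegB] at h2
    constructor <;> omega
  · -- degenerate case of Mason–Stothers: `A' = 0`, i.e. `A` constant — impossible, `deg A ≥ 4`
    have : A.natDegree = 0 := derivative_eq_zero.mp hdA
    omega

/-- **The floor for polynomial enemies.**  In characteristic `0`, a one-parameter polynomial identity
`w Z⁴ − v Y⁴ = a` (`v, w, a, Y ≠ 0`, `Z` non-constant, `gcd(wZ⁴, vY⁴) = 1`) has
`deg Z + 1 ≤ max (max (deg v) (deg w)) (deg a)`: such a family refutes the uniform binomial quartic saving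
`UBQ η` only for `η > 1 + 1/deg Z`, never for `η ≤ 1`. -/
theorem masonStothers_enemy_floor [CharZero k] {v w a Y Z : k[X]} (hv : v ≠ 0) (hw : w ≠ 0) (ha : a ≠ 0)
    (hY : Y ≠ 0) (hZ : 0 < Z.natDegree) (hcop : IsCoprime (w * Z ^ 4) (v * Y ^ 4))
    (hid : w * Z ^ 4 - v * Y ^ 4 = a) :
    Z.natDegree + 1 ≤ max (max v.natDegree w.natDegree) a.natDegree := by
  obtain ⟨h1, h2⟩ := masonStothers_enemy_ineq hv hw ha hY hZ hcop hid
  simp only [le_max_iff]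
  omega

end Summit.ABC.ABC.Theorems.TowerFourSubLiouville.Negative
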